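import Literature.AlgebraicGeometry.Frobenioids.BirationalizationIsFrobenioid
import Literature.AlgebraicGeometry.Frobenioids.ModelFrobenioidModelType
import Literature.AlgebraicGeometry.Frobenioids.ModelFrobenioidIsFrobenioid
import HarnessLib

/-!
# Frobenioids I, Theorem 5.2 (ii) + Proposition 4.4 (ii) (2024 form): the birationalization of a MODEL
# Frobenioid is a Frobenioid — PROVED (instance of `Birat.isFrobenioid`; non-vacuity certificate)

Mochizuki, *The geometry of Frobenioids I: the general theory*, Kyushu J. Math. **62** (2008)
293–400, §5, Theorem 5.2 (ii), kurims text p. 101 [cite: MochizukiFrdI2008, Thm. 5.2 (ii) p.101] (the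
model Frobenioid of `(Φ, B, Div_B)` "is of isotropic and model type"), combined with §4, Proposition
4.4 (ii) p. 83 in the author's corrected form (*Comments* (2024) (29)(i): "`C^birat` is a Frobenioid"
for `C` of birationally Frobenius-normalized type) [cite: MochizukiFrdI2008, Prop. 4.4 (ii) p.83].

PROOF-ONLY file (theorems only; seat abc-iut-L6-t20, abc-iut cell). For the model Frobenioid
`C = ModelFrobenioid Φ B Div_B` with `Φ` a divisorial monoid on `D`, `B` a group-like monoid on `D`,
`D` connected and totally epimorphic (the standing hypotheses of Thm. 5.2), THE birationalization
`C^birat → F_{0_D}` (`PreFrobenioid.Birat.toElemZero`, seat abc-iut-L6-t8) IS A FROBENIOID: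
`ModelFrobenioid.birat_isFrobenioid`. This instantiates row W14 of the cell
(`PreFrobenioid.Birat.isFrobenioid`, seats abc-iut-w5-d227 / abc-iut-L6-t20: isotropic +
birationally Frobenius-normalized ⇒ Frobenioid) at the tree's central example class — the two
hypotheses being Thm. 5.2 (ii) in the tree: `ModelFrobenioid.isOfIsotropicType` (seat abc-iut-found)
and `ModelFrobenioid.isOfModelType_of_hasBiratSquares` (seats abc-iut-w4-d103 / abc-iut-L1-d9
lineage, `ModelFrobenioidModelType.lean`, over `ModelFrobenioidBiratNormalized.lean`) — and thereby
certifies that the hypotheses of W14 are jointly satisfiable (no vacuity). Also the fully explicit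
form with `hF`, `hsq` discharged (`ModelFrobenioid.isFrobenioid`, `hasBiratSquares_of_isFrobenioid`).
No statement of the paper is strengthened; nothing here concerns the disputed parts of IUT.
-/

namespace Literature.AlgebraicGeometry.Frobenioids

open CategoryTheory Opposite

universe w v u

namespace ModelFrobenioid

variable {D : Type u} [Category.{v} D] {Φ B : Dᵒᵖ ⥤ CommMonCat.{w}} {DivB : B ⟶ monoidGp Φ}

/-- **The birationalization of a model Frobenioid is a Frobenioid** (Thm. 5.2 (ii): isotropic and model
— in particular birationally Frobenius-normalized — type; Prop. 4.4 (ii) in the 2024 form): for `Φ`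
divisorial and `B` group-like, given any Frobenioid structure proof `hF` of the model Frobenioid and any
square-completion datum `hsq`. [cite: MochizukiFrdI2008, Thm. 5.2 (ii) p.101] -/
theorem birat_isFrobenioid (hF : PreFrobenioid.IsFrobenioid (toElem Φ B DivB))
    (hsq : PreFrobenioid.HasBiratSquares (toElem Φ B DivB))
    (hΦd : Objectwise (fun M _ => IsDivisorial M) Φ)
    (hBg : Objectwise (fun M _ => IsGroupLike M) B) :
    PreFrobenioid.IsFrobenioid (PreFrobenioid.Birat.toElemZero hF hsq) :=
  PreFrobenioid.Birat.isFrobenioid_of_isOfModelType hF hsq (isOfIsotropicType hBg)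
    (isOfModelType_of_hasBiratSquares hF hsq hΦd hBg)

/-- **The birationalization of a model Frobenioid is a Frobenioid**, fully explicit form: under the
standing hypotheses of Thm. 5.2 (`Φ` a divisorial monoid on `D`, `B` a group-like monoid on `D`, `D`
connected and totally epimorphic) the model Frobenioid is a Frobenioid (`ModelFrobenioid.isFrobenioid`),
Prop. 1.11 (vii) supplies the squares (`hasBiratSquares_of_isFrobenioid`), and its birationalization
`C^birat → F_{0_D}` is a Frobenioid. [cite: MochizukiFrdI2008, Thm. 5.2 (ii) p.101] -/
theorem birat_isFrobenioid' (hΦ : IsMonoidOn Φ) (hΦd : Objectwise (fun M _ => IsDivisorial M) Φ)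
    (hB : IsMonoidOn B) (hBg : Objectwise (fun M _ => IsGroupLike M) B) (hDc : IsGraphConnected D)
    (hDe : IsTotallyEpimorphic D) :
    PreFrobenioid.IsFrobenioid
      (PreFrobenioid.Birat.toElemZero (isFrobenioid (DivB := DivB) hΦ hΦd hB hBg hDc hDe)
        (PreFrobenioid.hasBiratSquares_of_isFrobenioid
          (isFrobenioid (DivB := DivB) hΦ hΦd hB hBg hDc hDe))) :=
  birat_isFrobenioid _ _ hΦd hBg

end ModelFrobenioid

end Literature.AlgebraicGeometry.Frobenioids
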